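import Summits.CriticalPhenomena.PercolationContinuityZ3.Theorems.PercNearOneGluingNoHeavyLowerTailTerminalTwoSumGlue
import HarnessLib

/-!
# `NoHeavyLowerTail` (stmt-CriticalPhenomena-4575) — 2-sums through a terminal (the `{b, v}`-cut), part 2:
# Boolean tables (glued three-point cells as bilinear forms in the block cells)

Support file (prover prim-gen-kcluster gen 72; `--supports stmt-CriticalPhenomena-4575`).  No definitions, no named facts, no sorries.

Atoms of the `X`-block (`∋ a, b, v`): `αX = [b ∈ C(a)]`, `βX = [v ∈ C(a)]`, `δX = [b ∈ C(v)]`; of the `Y`-block (`∋ v, b, c`, instance `(v; b, c)`):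
`δY = [b ∈ C(v)]`, `γY = [c ∈ C(v)]`, `κY = [c ∈ C(b)]`, `νY = [C(v) cuts b|c in DY]`.  Glued atoms (part 1): `[b ∈ C(a)] = αX ∨ (βX ∧ (δX ∨ δY))`,
`[v ∈ C(a)] = βX ∨ (αX ∧ (δX ∨ δY))`, `[c ∈ C(a)] = ([b ∈ C(a)] ∧ κY) ∨ ([v ∈ C(a)] ∧ γY)`, `[b ~ v] = δX ∨ δY` (so the free count exceeds the
`{v,b}`-wired count by `r = q^{[¬(δX ∨ δY)]}`), and (given `b ∉ C(a)` and `b ~ c` in the support `DY`) `[C(a) cuts b|c] = [v ∈ C(a)] ∧ νY`.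
X-states `x1 = [αX ∧ βX]` (`{abv}`), `x2 = [αX ∧ ¬βX]` (`{ab|v}`), `x3 = [¬αX ∧ βX]` (`{av|b}`); Y-cells `yt, yb, yc, ya, ys, yn` = the six cells of `(v; b, c)`.
Tables (validated numerically: HOME/code/gen72/bvcut_check.py, 71 glued instances, q ∈ {1/2,1,2,7/2}, exact):
`1_T·r = x1(yt+yc+ya) + x2 yt + x3 yt + q x2 ya`, `1_{U_b}·r = x1(yb+ys+yn) + x2 yb + q x2(yc+ys+yn) + x3 yb`, `1_{U_c}·r = q x3 yc`, `1_S·r = q x3 ys`.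
-/

noncomputable section

namespace Summit.CriticalPhenomena.PercolationContinuityZ3.Theorems

namespace TerminalTwoSum

open Finset SimpleGraph Literature.Probability.Percolation Literature.Probability.Percolation.Gladkov
open Literature.Probability.Percolation.BHK2006 (weight)
open Literature.Probability.Percolation.DecisionTree (ind ind_of_mem ind_of_not_mem ind_nonneg)
open Literature.Probability.LatticeModels RefinedRowR3 ThreePointLB MeasureTheory
open scoped Classical

variable {V : Type*} [Fintype V]

section Tables

variable {αX βX δX δY γY κY νY : Prop} {x r q x1 x2 x3 yt yb yc ya ys yn : ℝ}

/-- Table of the cell `T = {b, c ∈ C(a)}`. [this work] -/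
theorem table_T (t1X : αX → βX → δX) (t2X : αX → δX → βX) (t3X : βX → δX → αX)
    (t1Y : δY → γY → κY) (t2Y : δY → κY → γY) (t3Y : γY → κY → δY) (nsY : ¬δY → κY → ¬νY)
    (hr1 : (δX ∨ δY) → r = 1) (hrq : ¬ (δX ∨ δY) → r = q)
    (hx1 : ((αX ∨ (βX ∧ (δX ∨ δY))) ∧ (((αX ∨ (βX ∧ (δX ∨ δY))) ∧ κY) ∨ ((βX ∨ (αX ∧ (δX ∨ δY))) ∧ γY))) → x = 1) (hx0 : ¬ ((αX ∨ (βX ∧ (δX ∨ δY))) ∧ (((αX ∨ (βX ∧ (δX ∨ δY))) ∧ κY) ∨ ((βX ∨ (αX ∧ (δX ∨ δY))) ∧ γY))) → x = 0)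
    (hx11 : (αX ∧ βX) → x1 = 1) (hx10 : ¬ (αX ∧ βX) → x1 = 0)
    (hx21 : (αX ∧ ¬βX) → x2 = 1) (hx20 : ¬ (αX ∧ ¬βX) → x2 = 0)
    (hx31 : (¬αX ∧ βX) → x3 = 1) (hx30 : ¬ (¬αX ∧ βX) → x3 = 0)
    (hyt1 : (δY ∧ γY) → yt = 1) (hyt0 : ¬ (δY ∧ γY) → yt = 0)
    (hyc1 : (¬δY ∧ γY) → yc = 1) (hyc0 : ¬ (¬δY ∧ γY) → yc = 0)
    (hya1 : (¬δY ∧ ¬γY ∧ κY) → ya = 1) (hya0 : ¬ (¬δY ∧ ¬γY ∧ κY) → ya = 0) :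
    x * r = x1 * (yt + yc + ya) + x2 * yt + x3 * yt + q * (x2 * ya) := by
  by_cases hαX : αX <;> by_cases hβX : βX <;> by_cases hδX : δX <;> by_cases hδY : δY <;>
    by_cases hγY : γY <;> by_cases hκY : κY <;> by_cases hνY : νY <;> simp_all

/-- Table of the cell `U_b = {b ∈ C(a), c ∉ C(a)}`. [this work] -/
theorem table_Ub (t1X : αX → βX → δX) (t2X : αX → δX → βX) (t3X : βX → δX → αX)
    (t1Y : δY → γY → κY) (t2Y : δY → κY → γY) (t3Y : γY → κY → δY) (nsY : ¬δY → κY → ¬νY)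
    (hr1 : (δX ∨ δY) → r = 1) (hrq : ¬ (δX ∨ δY) → r = q)
    (hx1 : ((αX ∨ (βX ∧ (δX ∨ δY))) ∧ ¬ (((αX ∨ (βX ∧ (δX ∨ δY))) ∧ κY) ∨ ((βX ∨ (αX ∧ (δX ∨ δY))) ∧ γY))) → x = 1) (hx0 : ¬ ((αX ∨ (βX ∧ (δX ∨ δY))) ∧ ¬ (((αX ∨ (βX ∧ (δX ∨ δY))) ∧ κY) ∨ ((βX ∨ (αX ∧ (δX ∨ δY))) ∧ γY))) → x = 0)
    (hx11 : (αX ∧ βX) → x1 = 1) (hx10 : ¬ (αX ∧ βX) → x1 = 0)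
    (hx21 : (αX ∧ ¬βX) → x2 = 1) (hx20 : ¬ (αX ∧ ¬βX) → x2 = 0)
    (hx31 : (¬αX ∧ βX) → x3 = 1) (hx30 : ¬ (¬αX ∧ βX) → x3 = 0)
    (hyb1 : (δY ∧ ¬γY) → yb = 1) (hyb0 : ¬ (δY ∧ ¬γY) → yb = 0)
    (hyc1 : (¬δY ∧ γY) → yc = 1) (hyc0 : ¬ (¬δY ∧ γY) → yc = 0)
    (hys1 : (¬δY ∧ ¬γY ∧ νY) → ys = 1) (hys0 : ¬ (¬δY ∧ ¬γY ∧ νY) → ys = 0)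
    (hyn1 : (¬δY ∧ ¬γY ∧ ¬κY ∧ ¬νY) → yn = 1) (hyn0 : ¬ (¬δY ∧ ¬γY ∧ ¬κY ∧ ¬νY) → yn = 0) :
    x * r = x1 * (yb + ys + yn) + x2 * yb + q * (x2 * (yc + ys + yn)) + x3 * yb := by
  by_cases hαX : αX <;> by_cases hβX : βX <;> by_cases hδX : δX <;> by_cases hδY : δY <;>
    by_cases hγY : γY <;> by_cases hκY : κY <;> by_cases hνY : νY <;> simp_all

/-- Table of the cell `U_c = {b ∉ C(a), c ∈ C(a)}`. [this work] -/
theorem table_Uc (t1X : αX → βX → δX) (t2X : αX → δX → βX) (t3X : βX → δX → αX)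
    (t1Y : δY → γY → κY) (t2Y : δY → κY → γY) (t3Y : γY → κY → δY) (nsY : ¬δY → κY → ¬νY)
    (hr1 : (δX ∨ δY) → r = 1) (hrq : ¬ (δX ∨ δY) → r = q)
    (hx1 : (¬ (αX ∨ (βX ∧ (δX ∨ δY))) ∧ (((αX ∨ (βX ∧ (δX ∨ δY))) ∧ κY) ∨ ((βX ∨ (αX ∧ (δX ∨ δY))) ∧ γY))) → x = 1) (hx0 : ¬ (¬ (αX ∨ (βX ∧ (δX ∨ δY))) ∧ (((αX ∨ (βX ∧ (δX ∨ δY))) ∧ κY) ∨ ((βX ∨ (αX ∧ (δX ∨ δY))) ∧ γY))) → x = 0)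
    (hx31 : (¬αX ∧ βX) → x3 = 1) (hx30 : ¬ (¬αX ∧ βX) → x3 = 0)
    (hyc1 : (¬δY ∧ γY) → yc = 1) (hyc0 : ¬ (¬δY ∧ γY) → yc = 0) :
    x * r = q * (x3 * yc) := by
  by_cases hαX : αX <;> by_cases hβX : βX <;> by_cases hδX : δX <;> by_cases hδY : δY <;>
    by_cases hγY : γY <;> by_cases hκY : κY <;> by_cases hνY : νY <;> simp_all

/-- Table of the separating cell `S` (separation flag `[v ∈ C(a)] ∧ νY` given `b ∉ C(a)`). [this work] -/
theorem table_S (t1X : αX → βX → δX) (t2X : αX → δX → βX) (t3X : βX → δX → αX)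
    (t1Y : δY → γY → κY) (t2Y : δY → κY → γY) (t3Y : γY → κY → δY) (nsY : ¬δY → κY → ¬νY)
    (hr1 : (δX ∨ δY) → r = 1) (hrq : ¬ (δX ∨ δY) → r = q)
    (hx1 : (¬ (αX ∨ (βX ∧ (δX ∨ δY))) ∧ ¬ (((αX ∨ (βX ∧ (δX ∨ δY))) ∧ κY) ∨ ((βX ∨ (αX ∧ (δX ∨ δY))) ∧ γY)) ∧ ((βX ∨ (αX ∧ (δX ∨ δY))) ∧ νY)) → x = 1)
    (hx0 : ¬ (¬ (αX ∨ (βX ∧ (δX ∨ δY))) ∧ ¬ (((αX ∨ (βX ∧ (δX ∨ δY))) ∧ κY) ∨ ((βX ∨ (αX ∧ (δX ∨ δY))) ∧ γY)) ∧ ((βX ∨ (αX ∧ (δX ∨ δY))) ∧ νY)) → x = 0)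
    (hx31 : (¬αX ∧ βX) → x3 = 1) (hx30 : ¬ (¬αX ∧ βX) → x3 = 0)
    (hys1 : (¬δY ∧ ¬γY ∧ νY) → ys = 1) (hys0 : ¬ (¬δY ∧ ¬γY ∧ νY) → ys = 0) :
    x * r = q * (x3 * ys) := by
  by_cases hαX : αX <;> by_cases hβX : βX <;> by_cases hδX : δX <;> by_cases hδY : δY <;>
    by_cases hγY : γY <;> by_cases hκY : κY <;> by_cases hνY : νY <;> simp_all

end Tables

end TerminalTwoSum

end Summit.CriticalPhenomena.PercolationContinuityZ3.Theorems
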